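/-
Copyright (c) 2026. All rights reserved.
Released under Apache 2.0 license as described in the file LICENSE.
Authors: abc-iut cell — seat abc-iut-f-104 (F fact-proving wave, tranche 104: FACT-LIST rows F-0182
`PanalocalizationExists`, F-0183 `PanalocalizationMapsHom` of `PanalocalTheaters.lean`), gen 3.
-/
import Literature.AnabelianGeometry.AbsoluteAnabelian.PanalocalTheatersStructural
import Literature.AnabelianGeometry.AbsoluteAnabelian.PanalocalTheatersMapsHom
import HarnessLib

/-!
# [AbsTopIII] Def 5.1 (iii)(a)/(iv), Cor 5.2 (v): along a GENERAL morphism `Π₁ ↪ Π₂` of `EA⊚`, `V⊚(−)` respects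
# `{⊚} ∪ V^non ∪ V^arc` for structural reasons — structural instance form of the panalocalization on morphisms

S. Mochizuki, *Topics in absolute anabelian geometry III: global reconstruction algorithms*, J. Math. Sci. Univ.
Tokyo 22 (2015) 939–1156 [MochizukiAbsTopIII2015]; manuscript locators as in the trunk file `PanalocalTheaters.lean`
(abc-iut-L4-t3): Def 5.1 (iii) pp. 115–116 ("(a) … `φ_Π` induces an open injection `Π_{v₁} ↪ Π_{v₂}`"), (iv) p. 116
("we obtain a natural panalocalization functor `Th⊚ → Th✠`"), Cor 5.2 (v) p. 120.

PROOF-ONLY companion (no `def` / `structure` / `instance`) of `PanalocalTheaters.lean`, sequel to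
`PanalocalTheatersStructural.lean` (automorphisms), for the FROZEN FACT-LIST row **F-0183** `PanalocalizationMapsHom`
(universal closure REFUTED, `PanalocalTheatersCountermodels.lean`; instance form `panalocalizationMapsHom_of_mapProVal_descends`
of `PanalocalTheatersMapsHom.lean` under (H1) "`V⊚(f)` respects `⊚`/non/arc along every `EA⊚`-morphism `f`", (H2) "`V⊚(f)`
descends to a bijection of the `Aut`-quotients", (H3) "`X(Π₁,ṽ) ≅ X(Π₂,V(f)ṽ)`").  Here (H1) is DERIVED, for every context and
every morphism `f : Π₁ ↪ Π₂` of `EA⊚` (open injection inducing `Δ₁ ≅ Δ₂`), from STRUCTURAL hypotheses on decomposition groups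
and the single interface law `mapProVal_smul`:

* §1: the `G`-component of an `EA⊚`-morphism is injective (`IsEAHom.gal_injective`: `Δ₁ ↠ Δ₂` and `Π₁ ↪ Π₂`);
  `f(Π_{1,v}) = Π_{2,V(f)v} ∩ f(Π₁)` (`map_decomp_eq_inf_range`) — print's (iii)(a); hence `Π_{2,V(f)v} = Π₂ ⟹ Π_{1,v} = Π₁`,
  `f_G(G_{1,v}) ⊆ G_{2,V(f)v}` (`map_galDecomp_le`), the decomposition group of `V(f)(⊚₁)` is OPEN
  (`isOpen_decomp_mapProVal_generic`), and — the one point needing topology — `G_{1,v}` finite ⟹ `G_{2,V(f)v}` finite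
  (`galDecomp_mapProVal_finite_of_finite`: `f(Π_{1,v})` is an open, hence finite-index, subgroup of the compact
  `Π_{2,V(f)v}`, and its image in `G₂` is `f_G(G_{1,v})`).
* §2: under (S⊚′) "only `⊚` has an OPEN decomposition group" on `Π₂`, (S⊚) "only `⊚` is fixed by all of `Π`" on `Π₁`,
  (S_arc) "`G_v` finite for archimedean `v`" and (S_non) "`G_v` infinite for nonarchimedean `v`" (on both sides):
  `V(f)(⊚₁) = ⊚₂`, `V(f)(V^non₁) ⊆ V^non₂`, `V(f)(V^arc₁) ⊆ V^arc₂` (`mapProVal_generic_of_decomp_hom`,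
  `mapProVal_mem_non_of_decomp_hom`, `mapProVal_mem_arc_of_decomp_hom`).  In print all four hold (`G_⊚ = G_F` ⊇ every `G_v` with
  infinite index; `G_v = Gal(F̄_v/F_v)` infinite; `|G_v| ≤ 2` at archimedean `v`).
* §3 (**F-0183**, structural instance form): (S⊚′) ∧ (S_arc) ∧ (S_non) at admissible `Π` + (H2) + (H3) ⟹
  `PanalocalizationMapsHom R` (`panalocalizationMapsHom_of_decompositionStructure`).
* §4: (S⊚′) at the GENUINE pro-set `V⊚(F̄/F)` of a number field (abc-iut-L4-d2's `NumberField.valuationProSet`), archimedean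
  half: the (finite) decomposition group of an infinite place of `F̄` is NOT open in the infinite compact group `G_F`
  (`NumberFieldValuationProSet.not_isOpen_decomp_inr_inr`, `….not_mem_arc_of_isOpen_decomp`).  The nonarchimedean halves
  ("`D_v` has infinite index / is infinite" for finite places) are classical (`D_v ≅ Gal(F̄_v/F_v)`) and NOT proved here.

HONEST LABEL: instance form for the interface record `GlobalAnabelianContext`; no genuine context is assembled in the tree
(GAP G-L4d2g4-1), so nothing here DISCHARGES F-0183 at the intended model; refereed pre-IUT anabelian geometry / classical
algebraic number theory; nothing here bears on, and no side is taken on, [IUTchIII] Cor. 3.12; typed ≠ proved.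
-/

set_option autoImplicit false

namespace Literature.AnabelianGeometry.AbsoluteAnabelian

open CategoryTheory Topology

universe u

/-! ### §1: decomposition groups along a general morphism of `EA⊚` -/

/-- The `G`-component `G₁ → G₂` of a morphism of `EA⊚` is INJECTIVE: `Π₁ ↪ Π₂` is injective and maps `Δ₁` onto `Δ₂`.
[cite: MochizukiAbsTopIII2015, Def 5.1 (iii) p. 115] -/
theorem IsEAHom.gal_injective {E₁ E₂ : FundamentalExtension.{u}} {f : E₁ ⟶ E₂} (hf : IsEAHom f) :
    Function.Injective f.gal := by
  intro a b hab
  obtain ⟨x, rfl⟩ := E₁.aug_surjective a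
  obtain ⟨y, rfl⟩ := E₁.aug_surjective b
  have h1 : f.arith (x⁻¹ * y) ∈ E₂.geom := by
    simp only [FundamentalExtension.mem_geom, f.comm, map_mul, map_inv, hab, inv_mul_cancel]
  obtain ⟨d, hd, hdf⟩ := hf.bijOn_geom.surjOn h1
  have h2 : x⁻¹ * y ∈ E₁.geom := by
    rw [← hf.injective hdf]
    exact hd
  rw [FundamentalExtension.mem_geom, map_mul, map_inv, inv_mul_eq_one] at h2
  exact h2

namespace GlobalAnabelianContext

variable {R : GlobalAnabelianContext.{u}}

/-- **`f(Π_{1,v}) = Π_{2,V(f)v} ∩ f(Π₁)`** along a morphism `f : Π₁ ↪ Π₂` of `EA⊚` ("`φ_Π` induces an open injection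
`Π_{v₁} ↪ Π_{v₂}`", Def 5.1 (iii)(a)): the equivariance law `mapProVal_smul` and injectivity.
[cite: MochizukiAbsTopIII2015, Def 5.1 (iii) p. 116] -/
theorem map_decomp_eq_inf_range {E₁ E₂ : FundamentalExtension.{u}} (f : E₁ ⟶ E₂) (hf : IsEAHom f)
    (v : (R.proVal E₁).carrier) :
    ((R.proVal E₁).decomp v).map f.arith.toMonoidHom =
      (R.proVal E₂).decomp (R.mapProVal f hf v) ⊓ f.arith.toMonoidHom.range := by
  ext h
  rw [Subgroup.mem_map, Subgroup.mem_inf, MonoidHom.mem_range]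
  constructor
  · rintro ⟨g, hg, rfl⟩
    exact ⟨(mem_decomp_mapProVal_iff f hf v g).mpr hg, g, rfl⟩
  · rintro ⟨hh, g, rfl⟩
    exact ⟨g, (mem_decomp_mapProVal_iff f hf v g).mp hh, rfl⟩

/-- Along a morphism `f : Π₁ ↪ Π₂` of `EA⊚`: if the decomposition group of `V(f)(v)` is all of `Π₂`, then that of `v`
is all of `Π₁`. [cite: MochizukiAbsTopIII2015, Def 5.1 (iii) p. 116] -/
theorem decomp_eq_top_of_mapProVal {E₁ E₂ : FundamentalExtension.{u}} (f : E₁ ⟶ E₂) (hf : IsEAHom f)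
    (v : (R.proVal E₁).carrier) (h : (R.proVal E₂).decomp (R.mapProVal f hf v) = ⊤) :
    (R.proVal E₁).decomp v = ⊤ := by
  rw [eq_top_iff]
  intro g _
  have hg : f.arith g ∈ ((R.proVal E₁).decomp v).map f.arith.toMonoidHom := by
    rw [map_decomp_eq_inf_range f hf v, h]
    exact ⟨Subgroup.mem_top _, g, rfl⟩
  rw [Subgroup.mem_map] at hg
  obtain ⟨g', hg', hgg'⟩ := hg
  have : g' = g := hf.injective hgg'
  exact this ▸ hg'

/-- Along a morphism `f : Π₁ ↪ Π₂` of `EA⊚`, the decomposition group of `V(f)(⊚₁)` contains the open subgroup `f(Π₁)`.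
[cite: MochizukiAbsTopIII2015, Def 5.1 (iii) p. 116] -/
theorem range_le_decomp_mapProVal_generic {E₁ E₂ : FundamentalExtension.{u}} (f : E₁ ⟶ E₂) (hf : IsEAHom f) :
    f.arith.toMonoidHom.range ≤ (R.proVal E₂).decomp (R.mapProVal f hf (R.proVal E₁).generic) := by
  rintro _ ⟨g, rfl⟩
  refine (mem_decomp_mapProVal_iff f hf _ g).mpr ?_
  rw [decomp_generic_eq_top]
  exact Subgroup.mem_top g

/-- Along a morphism `f : Π₁ ↪ Π₂` of `EA⊚`, the decomposition group of `V(f)(⊚₁)` is OPEN in `Π₂` (it contains the open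
subgroup `f(Π₁)`). [cite: MochizukiAbsTopIII2015, Def 5.1 (iii) p. 116] -/
theorem isOpen_decomp_mapProVal_generic {E₁ E₂ : FundamentalExtension.{u}} (f : E₁ ⟶ E₂) (hf : IsEAHom f) :
    IsOpen ((R.proVal E₂).decomp (R.mapProVal f hf (R.proVal E₁).generic) : Set E₂.arith) := by
  refine Subgroup.isOpen_mono (range_le_decomp_mapProVal_generic f hf) ?_
  rw [MonoidHom.coe_range]
  exact hf.isOpen_range

/-- **`f_G(G_{1,v}) ⊆ G_{2,V(f)v}`** along a morphism `f : Π₁ ↪ Π₂` of `EA⊚` (images in `G` of the decomposition groups).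
[cite: MochizukiAbsTopIII2015, Def 5.1 (iii) p. 116] -/
theorem map_galDecomp_le {E₁ E₂ : FundamentalExtension.{u}} (f : E₁ ⟶ E₂) (hf : IsEAHom f)
    (v : (R.proVal E₁).carrier) :
    (R.galDecomp E₁ v).map f.gal.toMonoidHom ≤ R.galDecomp E₂ (R.mapProVal f hf v) := by
  intro x hx
  simp only [galDecomp, Subgroup.mem_map] at hx ⊢
  obtain ⟨y, ⟨g, hg, rfl⟩, rfl⟩ := hx
  exact ⟨f.arith g, (mem_decomp_mapProVal_iff f hf v g).mpr hg, f.comm g⟩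

/-- **`G_{1,v}` finite ⟹ `G_{2,V(f)v}` finite** along a morphism `f : Π₁ ↪ Π₂` of `EA⊚`: `f(Π_{1,v}) = Π_{2,V(f)v} ∩ f(Π₁)` is an
OPEN subgroup of the compact group `Π_{2,V(f)v}`, hence of finite index, and its image in `G₂` is `f_G(G_{1,v})`; so `G_{2,V(f)v}`
has a finite subgroup of finite index. [cite: MochizukiAbsTopIII2015, Def 5.1 (iii) p. 116] -/
theorem galDecomp_mapProVal_finite_of_finite {E₁ E₂ : FundamentalExtension.{u}} (f : E₁ ⟶ E₂) (hf : IsEAHom f)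
    (v : (R.proVal E₁).carrier) (hfin : (R.galDecomp E₁ v : Set E₁.gal).Finite) :
    (R.galDecomp E₂ (R.mapProVal f hf v) : Set E₂.gal).Finite := by
  -- the decomposition group `D = Π_{2,w}` of `w := V(f)(v)`, a compact group
  set w := R.mapProVal f hf v with hw
  set D : Subgroup E₂.arith := (R.proVal E₂).decomp w with hD
  haveI : CompactSpace D := isCompact_iff_compactSpace.mp ((R.proVal E₂).isClosed_decomp w).isCompact
  -- its open subgroup `K = D ∩ f(Π₁)`, of finite index
  set K : Subgroup D := (f.arith.toMonoidHom.range).subgroupOf D with hK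
  have hKopen : IsOpen (K : Set D) := by
    have hKset : (K : Set D) = Subtype.val ⁻¹' Set.range f.arith := by
      ext d
      rw [SetLike.mem_coe, hK, Subgroup.mem_subgroupOf, MonoidHom.mem_range, Set.mem_preimage, Set.mem_range]
      rfl
    rw [hKset]
    exact hf.isOpen_range.preimage continuous_subtype_val
  haveI : Finite (D ⧸ K) := Subgroup.quotient_finite_of_isOpen K hKopen
  haveI hKfi : K.FiniteIndex := Subgroup.finiteIndex_of_finite_quotient
  -- `ψ = aug₂|_D : D → G₂`; `ψ(K) ⊆ f_G(G_{1,v})` is finite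
  set ψ : D →* E₂.gal := E₂.aug.toMonoidHom.comp D.subtype with hψ
  have hψK : (ψ '' (K : Set D)).Finite := by
    refine (hfin.image f.gal).subset ?_
    rintro _ ⟨d, hd, rfl⟩
    have hd' : (d : E₂.arith) ∈ f.arith.toMonoidHom.range := by
      rw [SetLike.mem_coe, hK, Subgroup.mem_subgroupOf] at hd
      exact hd
    obtain ⟨g, hg⟩ := MonoidHom.mem_range.mp hd'
    change f.arith g = (d : E₂.arith) at hg
    have hgv : g ∈ (R.proVal E₁).decomp v := by
      refine (mem_decomp_mapProVal_iff f hf v g).mp ?_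
      rw [← hw, ← hD, hg]
      exact d.2
    refine ⟨E₁.aug g, ?_, ?_⟩
    · simp only [galDecomp, SetLike.mem_coe, Subgroup.mem_map]
      exact ⟨g, hgv, rfl⟩
    · change f.gal (E₁.aug g) = E₂.aug (d : E₂.arith)
      rw [← f.comm]
      exact congrArg E₂.aug hg
  -- `H = ψ(K)` inside the group `ψ(D)`: finite, of finite index; so `ψ(D)` is finite
  set H : Subgroup ψ.range := K.map ψ.rangeRestrict with hH
  have hHfin : (H : Set ψ.range).Finite := by
    have h1 : Subtype.val '' (H : Set ψ.range) = ψ '' (K : Set D) := by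
      ext y
      constructor
      · rintro ⟨z, hz, rfl⟩
        rw [SetLike.mem_coe, hH, Subgroup.mem_map] at hz
        obtain ⟨d, hd, rfl⟩ := hz
        exact ⟨d, hd, rfl⟩
      · rintro ⟨d, hd, rfl⟩
        refine ⟨ψ.rangeRestrict d, ?_, rfl⟩
        rw [SetLike.mem_coe, hH, Subgroup.mem_map]
        exact ⟨d, hd, rfl⟩
    exact (Set.finite_image_iff Subtype.val_injective.injOn).mp (h1 ▸ hψK)
  haveI : Finite H := hHfin.to_subtype
  have hHidx : H.index ≠ 0 := by
    have hdvd : H.index ∣ K.index := K.index_map_dvd ψ.rangeRestrict_surjective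
    intro h0
    rw [h0] at hdvd
    exact Subgroup.index_ne_zero_of_finite (Nat.eq_zero_of_zero_dvd hdvd)
  have hcard : Nat.card ψ.range ≠ 0 := by
    rw [← H.index_mul_card]
    exact mul_ne_zero hHidx (Nat.card_pos (α := H)).ne'
  have hfinR : (ψ.range : Set E₂.gal).Finite := Set.finite_coe_iff.mp (Nat.finite_of_card_ne_zero hcard)
  -- and `ψ(D) = G_{2,w}`
  have hrange : ψ.range = R.galDecomp E₂ w := by
    rw [hψ, ← MonoidHom.map_range, Subgroup.range_subtype, hD]
    rfl
  rwa [hrange] at hfinR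

/-! ### §2: structural hypotheses ⟹ `V⊚(f)` respects `{⊚} ∪ V^non ∪ V^arc` -/

section StructureHom

variable {E₁ E₂ : FundamentalExtension.{u}} (f : E₁ ⟶ E₂) (hf : IsEAHom f)
  (hopen₂ : ∀ w : (R.proVal E₂).carrier,
    IsOpen ((R.proVal E₂).decomp w : Set E₂.arith) → w = (R.proVal E₂).generic)
  (hfix₁ : ∀ v : (R.proVal E₁).carrier, (R.proVal E₁).decomp v = ⊤ → v = (R.proVal E₁).generic)
  (harcFin₁ : ∀ v : (R.proVal E₁).carrier, v ∈ (R.proVal E₁).arc → (R.galDecomp E₁ v : Set E₁.gal).Finite)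
  (hnonInf₁ : ∀ v : (R.proVal E₁).carrier, v ∈ (R.proVal E₁).non → (R.galDecomp E₁ v : Set E₁.gal).Infinite)
  (harcFin₂ : ∀ w : (R.proVal E₂).carrier, w ∈ (R.proVal E₂).arc → (R.galDecomp E₂ w : Set E₂.gal).Finite)
  (hnonInf₂ : ∀ w : (R.proVal E₂).carrier, w ∈ (R.proVal E₂).non → (R.galDecomp E₂ w : Set E₂.gal).Infinite)

include hopen₂ in
/-- (S⊚′) on `Π₂` ⟹ `V(f)(⊚₁) = ⊚₂` along every morphism `f : Π₁ ↪ Π₂` of `EA⊚` (hypothesis `hgen` of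
`panalocalizationMapsHom_of_mapProVal_descends`, DERIVED). [cite: MochizukiAbsTopIII2015, Def 5.1 (iv) p. 116] -/
theorem mapProVal_generic_of_decomp_hom :
    R.mapProVal f hf (R.proVal E₁).generic = (R.proVal E₂).generic :=
  hopen₂ _ (isOpen_decomp_mapProVal_generic f hf)

include hfix₁ hnonInf₁ harcFin₂ in
/-- (S⊚) on `Π₁` ∧ (S_non) on `Π₁` ∧ (S_arc) on `Π₂` ⟹ `V(f)(V^non₁) ⊆ V^non₂` along every morphism `f : Π₁ ↪ Π₂` of `EA⊚`
(hypothesis `hnon`, DERIVED). [cite: MochizukiAbsTopIII2015, Def 5.1 (iv) p. 116] -/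
theorem mapProVal_mem_non_of_decomp_hom (v : (R.proVal E₁).carrier) (hv : v ∈ (R.proVal E₁).non) :
    R.mapProVal f hf v ∈ (R.proVal E₂).non := by
  rcases (R.proVal E₂).eq_generic_or_mem (R.mapProVal f hf v) with h | h | h
  · have h1 : (R.proVal E₂).decomp (R.mapProVal f hf v) = ⊤ := by
      rw [h]
      exact decomp_generic_eq_top E₂
    have h2 : v = (R.proVal E₁).generic := hfix₁ v (decomp_eq_top_of_mapProVal f hf v h1)
    exact absurd (h2 ▸ hv) (R.proVal E₁).generic_notMem_non
  · exact h
  · refine absurd (harcFin₂ _ h) (Set.Infinite.mono ?_ ((hnonInf₁ v hv).image hf.gal_injective.injOn))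
    rintro _ ⟨x, hx, rfl⟩
    exact map_galDecomp_le f hf v (Subgroup.mem_map.mpr ⟨x, hx, rfl⟩)

include hfix₁ harcFin₁ hnonInf₂ in
/-- (S⊚) on `Π₁` ∧ (S_arc) on `Π₁` ∧ (S_non) on `Π₂` ⟹ `V(f)(V^arc₁) ⊆ V^arc₂` along every morphism `f : Π₁ ↪ Π₂` of `EA⊚`
(hypothesis `harc`, DERIVED). [cite: MochizukiAbsTopIII2015, Def 5.1 (iv) p. 116] -/
theorem mapProVal_mem_arc_of_decomp_hom (v : (R.proVal E₁).carrier) (hv : v ∈ (R.proVal E₁).arc) :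
    R.mapProVal f hf v ∈ (R.proVal E₂).arc := by
  rcases (R.proVal E₂).eq_generic_or_mem (R.mapProVal f hf v) with h | h | h
  · have h1 : (R.proVal E₂).decomp (R.mapProVal f hf v) = ⊤ := by
      rw [h]
      exact decomp_generic_eq_top E₂
    have h2 : v = (R.proVal E₁).generic := hfix₁ v (decomp_eq_top_of_mapProVal f hf v h1)
    exact absurd (h2 ▸ hv) (R.proVal E₁).generic_notMem_arc
  · exact absurd (galDecomp_mapProVal_finite_of_finite f hf v (harcFin₁ v hv)) (hnonInf₂ _ h)
  · exact h

end StructureHom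

end GlobalAnabelianContext

/-! ### §3 (F-0183): the structural instance form of the panalocalization on morphisms -/

/-- **F-0183 (Def 5.1 (iv) / Cor 5.2 (v), weak morphism part), STRUCTURAL INSTANCE FORM — for EVERY context in which, at each
admissible `Π`, (S⊚′) only `⊚` has an open decomposition group, (S_arc) `G_v` is finite for archimedean `v`, (S_non) `G_v` is
infinite for nonarchimedean `v`, and along every `EA⊚`-morphism (H2) `V⊚(f)` descends to a bijection
`V⊚(Π₁)/Aut(Π₁) ≅ V⊚(Π₂)/Aut(Π₂)` and (H3) `X(Π₁,ṽ) ≅ X(Π₂,V(f)ṽ)`:** morphisms of `EA⊚` induce morphisms between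
panalocalizations — `panalocalizationMapsHom_of_mapProVal_descends` with its hypothesis (H1) DERIVED from the structure of
decomposition groups. [cite: MochizukiAbsTopIII2015, Def 5.1 (iv) p. 116] -/
theorem panalocalizationMapsHom_of_decompositionStructure (R : GlobalAnabelianContext.{u})
    (hopen : ∀ E, R.IsAdmissible E → ∀ v : (R.proVal E).carrier,
      IsOpen ((R.proVal E).decomp v : Set E.arith) → v = (R.proVal E).generic)
    (harcFin : ∀ E, R.IsAdmissible E → ∀ v : (R.proVal E).carrier,
      v ∈ (R.proVal E).arc → (R.galDecomp E v : Set E.gal).Finite)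
    (hnonInf : ∀ E, R.IsAdmissible E → ∀ v : (R.proVal E).carrier,
      v ∈ (R.proVal E).non → (R.galDecomp E v : Set E.gal).Infinite)
    (hβ : ∀ {E₁ E₂ : FundamentalExtension.{u}} (f : E₁ ⟶ E₂) (hf : IsEAHom f),
      R.IsAdmissible E₁ → R.IsAdmissible E₂ → ∃ β : R.ProValModAut E₁ ≃ R.ProValModAut E₂,
        ∀ v, β (R.toModAut E₁ v) = R.toModAut E₂ (R.mapProVal f hf v))
    (hX : ∀ {E₁ E₂ : FundamentalExtension.{u}} (f : E₁ ⟶ E₂) (hf : IsEAHom f), R.IsAdmissible E₁ →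
      R.IsAdmissible E₂ → ∀ (v : (R.proVal E₁).arc) (hv : R.mapProVal f hf v.1 ∈ (R.proVal E₂).arc),
      Nonempty (AutHolOrbispace.Iso (R.archSpace E₁ v) (R.archSpace E₂ ⟨R.mapProVal f hf v.1, hv⟩))) :
    PanalocalizationMapsHom R := by
  have hfix : ∀ E, R.IsAdmissible E → ∀ v : (R.proVal E).carrier,
      (R.proVal E).decomp v = ⊤ → v = (R.proVal E).generic := fun E hE v hv =>
    hopen E hE v (by rw [hv, Subgroup.coe_top]; exact isOpen_univ)
  exact panalocalizationMapsHom_of_mapProVal_descends R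
    (fun f hf _ h₂ => GlobalAnabelianContext.mapProVal_generic_of_decomp_hom f hf (hopen _ h₂))
    (fun f hf h₁ h₂ v hv => GlobalAnabelianContext.mapProVal_mem_non_of_decomp_hom f hf
      (hfix _ h₁) (hnonInf _ h₁) (harcFin _ h₂) v hv)
    (fun f hf h₁ h₂ v hv => GlobalAnabelianContext.mapProVal_mem_arc_of_decomp_hom f hf
      (hfix _ h₁) (harcFin _ h₁) (hnonInf _ h₂) v hv)
    hβ (fun f hf h₁ h₂ v => hX f hf h₁ h₂ v _)

/-! ### §4: (S⊚′) at the GENUINE pro-set `V⊚(F̄/F)`, archimedean half -/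

namespace NumberFieldValuationProSet

open Field NumberField

variable (F : Type) [Field F]

/-- At `V⊚(F̄/F)` for a NUMBER FIELD `F`: the decomposition group of an archimedean local element (finite, of order `≤ 2`) is
NOT OPEN in `G_F` — an open subgroup of the compact group `G_F` has finite index, and `G_F` is infinite.
[cite: MochizukiAbsTopIII2015, Def 5.1 (iii) p. 115] -/
theorem not_isOpen_decomp_inr_inr [NumberField F] (w : Arch F) :
    ¬ IsOpen (((NumberField.valuationProSet F).decomp (Sum.inr (Sum.inr w))) : Set (absoluteGaloisGroup F)) := by
  intro hopen
  set D := (NumberField.valuationProSet F).decomp (Sum.inr (Sum.inr w)) with hD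
  haveI : Finite (absoluteGaloisGroup F ⧸ D) := Subgroup.quotient_finite_of_isOpen D hopen
  haveI : D.FiniteIndex := Subgroup.finiteIndex_of_finite_quotient
  haveI : Finite D := (finite_decomp_inr_inr F w).to_subtype
  have hcard : Nat.card (absoluteGaloisGroup F) ≠ 0 := by
    rw [← D.index_mul_card]
    exact mul_ne_zero Subgroup.index_ne_zero_of_finite (Nat.card_pos (α := D)).ne'
  haveI := NumberField.infinite_absoluteGaloisGroup F
  exact hcard Nat.card_eq_zero_of_infinite

/-- At `V⊚(F̄/F)` for a number field `F`: the ARCHIMEDEAN HALF of (S⊚′) — an element with OPEN decomposition group is not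
archimedean. [cite: MochizukiAbsTopIII2015, Def 5.1 (i) p. 113] -/
theorem not_mem_arc_of_isOpen_decomp [NumberField F] (v : (NumberField.valuationProSet F).carrier)
    (h : IsOpen ((NumberField.valuationProSet F).decomp v : Set (absoluteGaloisGroup F))) :
    v ∉ (NumberField.valuationProSet F).arc := by
  rintro ⟨w, rfl⟩
  exact not_isOpen_decomp_inr_inr F w h

end NumberFieldValuationProSet

end Literature.AnabelianGeometry.AbsoluteAnabelian
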